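import Summits.ABC.ABC.Theses.RootDecompH
import HarnessLib

/-!
# Route RootDecompH — `Assembly` (item stmt-ABC-27947)

`NontrivialLevelFloor → BoundedExponentABC → ABC` (`Summit.ABC.ABC.Theses.RootDecompH.Assembly`), proved unconditionally: the route's
root pieces are its hypotheses, nothing else is assumed.  Pick a prime p ≥ p₀(ε); a triple with a p-th power tower is served by the non-trivial level floor (p-free conductor ≤ rad), the others have all exponents < p and are served by bounded-exponent abc.

The proof is the body of the route's deciding theorem `RootDecompH.closes` copied VERBATIM rather than
a citation of `closes`, so that this file keeps compiling under any later re-glue of the route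
(cell decomp-abc, writer LANDING LIST; D-0178 root decomposition, door H).  Bookkeeping only: nothing
here proves `ABC` or decides the route's declared residual.
-/

set_option linter.dupNamespace false

namespace Summit.ABC.ABC.Theorems

/-- Item stmt-ABC-27947, literally the route decl `RootDecompH.Assembly` (`NontrivialLevelFloor → BoundedExponentABC → ABC`). -/
theorem rootDecompH_assembly_proof : Summit.ABC.ABC.Theses.RootDecompH.Assembly := by
  unfold Summit.ABC.ABC.Theses.RootDecompH.Assembly
  intro hN hH
  rw [_root_.ABC_iff]
  intro ε hε
  obtain ⟨p₀, K₁, hK₁, h₁⟩ := hN ε hε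
  obtain ⟨p, hp₀p, hp⟩ := Nat.exists_infinite_primes p₀
  obtain ⟨K₂, hK₂, h₂⟩ := hH p ε hε
  refine ⟨max K₁ K₂, lt_max_of_lt_left hK₁, fun a b c ht => ?_⟩
  have ha : 0 < a := ht.1
  have hb : 0 < b := ht.2.1
  have hc : 0 < c := by have := ht.2.2.1; omega
  have hn0 : a * b * c ≠ 0 := by positivity
  have hrad0 : (Literature.NumberTheory.DiophantineGeometry.rad a b c : ℕ) ≠ 0 := by
    rw [Literature.NumberTheory.DiophantineGeometry.rad_def]
    exact UniqueFactorizationMonoid.radical_ne_zero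
  have hrad1 : (1 : ℝ) ≤ ((Literature.NumberTheory.DiophantineGeometry.rad a b c : ℕ) : ℝ) := by
    exact_mod_cast Nat.one_le_iff_ne_zero.mpr hrad0
  have hRpos : (0 : ℝ) < ((Literature.NumberTheory.DiophantineGeometry.rad a b c : ℕ) : ℝ) ^ (1 + ε) :=
    Real.rpow_pos_of_pos (by linarith) _
  by_cases hnt : ∃ q : ℕ, q.Prime ∧ q ^ p ∣ a * b * c
  · have hlt := h₁ p hp hp₀p a b c ht hnt
    have key : (((a * b * c).primeFactors.filter (fun q => ¬ p ∣ (a * b * c).factorization q)).prod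
        (fun q => q) : ℕ) ≤ (Literature.NumberTheory.DiophantineGeometry.rad a b c : ℕ) := by
      rw [Literature.NumberTheory.DiophantineGeometry.rad_def, Nat.radical_eq_prod_primeFactors]
      exact Finset.prod_le_prod_of_subset_of_one_le' (Finset.filter_subset _ _)
        (fun q hq _ => (Nat.prime_of_mem_primeFactors hq).one_lt.le)
    have hle : ((((a * b * c).primeFactors.filter (fun q => ¬ p ∣ (a * b * c).factorization q)).prod
        (fun q => q) : ℕ) : ℝ) ≤ ((Literature.NumberTheory.DiophantineGeometry.rad a b c : ℕ) : ℝ) := by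
      exact_mod_cast key
    calc (c : ℝ) < K₁ * ((((a * b * c).primeFactors.filter
            (fun q => ¬ p ∣ (a * b * c).factorization q)).prod (fun q => q) : ℕ) : ℝ) ^ (1 + ε) := hlt
      _ ≤ K₁ * ((Literature.NumberTheory.DiophantineGeometry.rad a b c : ℕ) : ℝ) ^ (1 + ε) := by
          gcongr
      _ ≤ max K₁ K₂ * ((Literature.NumberTheory.DiophantineGeometry.rad a b c : ℕ) : ℝ) ^ (1 + ε) := by
          gcongr; exact le_max_left _ _
  · have he : ((a * b * c).primeFactors.sup fun q => (a * b * c).factorization q) ≤ p := by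
      apply Finset.sup_le
      intro q hq
      by_contra hlt
      push Not at hlt
      exact hnt ⟨q, Nat.prime_of_mem_primeFactors hq,
        ((Nat.prime_of_mem_primeFactors hq).pow_dvd_iff_le_factorization hn0).2 hlt.le⟩
    calc (c : ℝ) < K₂ * ((Literature.NumberTheory.DiophantineGeometry.rad a b c : ℕ) : ℝ) ^ (1 + ε) :=
          h₂ a b c ht he
      _ ≤ max K₁ K₂ * ((Literature.NumberTheory.DiophantineGeometry.rad a b c : ℕ) : ℝ) ^ (1 + ε) := by
          gcongr; exact le_max_right _ _

end Summit.ABC.ABC.Theorems
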